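import Literature.NumberTheory.EllipticCurves.KugaSatoVariety
import HarnessLib

/-!
# The action of `SL₂(ℤ/N)` on full level-`N` structures

Topic: `Literature/NumberTheory/EllipticCurves`. Companion to `KugaSatoVariety.lean`
(`EllCurveOver.LevelStructure N C`: sections `P, Q` of `E → S` giving a `ℤ/N`-basis of the
`N`-torsion of every geometric fibre; `φ.section_ (a, b) = P^a Q^b`). The group `GL₂(ℤ/N)` acts on
level structures by `α ↦ α ∘ g` (Deligne (3.7): "le groupe `GL₂(ℤ/n)` agit sur `M_n` par
`α ↦ α ∘ g`"; Deninger–Scholl (4.10); Katz–Mazur (3.1)); the field `KugaSatoVariety.sl_extends`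
uses it for `g ∈ SL₂(ℤ/N)`, asking for the classifying morphism of the pair
`(E, (P^{g₀₀} Q^{g₁₀}, P^{g₀₁} Q^{g₁₁}))`. This file proves that this pair IS a level-`N`
structure, so that `FullLevelModularCurve.classify` applies to it:

* `LevelStructure.vecAct`, `vecActEquiv` — the action `(x, y) ↦ γ · (x, y)ᵀ` of `2 × 2` matrices
  on `(ℤ/N)²`, a bijection for `γ ∈ SL₂(ℤ/N)` (elementary);
* `LevelStructure.section_pow_mul_section_pow` — for commuting `P, Q`:
  `φ(u)^x · φ(v)^y = φ(u x + v y)`, i.e. `(a, b) ↦ P^a Q^b` is additive;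
* `LevelStructure.twist φ hc γ` — the level structure `(φ(γ₀₀, γ₁₀), φ(γ₀₁, γ₁₁)) = φ ∘ γ`, with
  `twist_P`, `twist_Q` (definitional unfoldings matching `KugaSatoVariety.sl_extends`);
* `LevelStructure.twistGL φ hc γ` — the same for `γ ∈ GL₂(ℤ/N) = (M₂(ℤ/N))ˣ` (the full action
  of Deligne (3.7) / Deninger–Scholl (4.10)), `vecActEquivOfUnit`, `twistGL_P/Q/section_`.

On the hypothesis `hc : Commute φ.P φ.Q`. The sections of an elliptic curve commute (`E/S` is a
commutative group scheme, Katz–Mazur Thm. 2.1.2), but `EllCurveOver` deliberately does not record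
commutativity (see the design notes of `KugaSatoVariety.lean`), and it does not follow formally
from the `LevelStructure` axioms (in `ℤ/4 ⋊ ℤ/4` the elements `P^a Q^b` are exactly the solutions of
`x⁴ = 1`); so it is taken as an explicit hypothesis, discharged in applications by the
commutativity of the curve at hand. No named facts.

## References

* P. Deligne, *Formes modulaires et représentations ℓ-adiques*, Sém. Bourbaki 355 (1969), (3.7).
  [Deligne1971Bourbaki355]
* N. Katz, B. Mazur, *Arithmetic moduli of elliptic curves* (1985), (3.1). [KatzMazur1985]
* C. Deninger, A. J. Scholl, *The Beilinson conjectures* (1991), (4.10). [DeningerScholl1991]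
-/

universe u

open CategoryTheory Limits AlgebraicGeometry MonoidalCategory CartesianMonoidalCategory
open scoped MonObj MatrixGroups

noncomputable section

namespace Literature.NumberTheory.EllipticCurves

namespace EllCurveOver.LevelStructure

/-! ### The action of `2 × 2` matrices on `(ℤ/N)²` -/

section VecAct

variable {N : ℕ}

/-- The action of a `2 × 2` matrix `γ` over `ℤ/N` on pairs: `(x, y) ↦ γ · (x, y)ᵀ =
(γ₀₀ x + γ₀₁ y, γ₁₀ x + γ₁₁ y)`. [folklore] -/
def vecAct (γ : Matrix (Fin 2) (Fin 2) (ZMod N)) (xy : ZMod N × ZMod N) : ZMod N × ZMod N :=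
  (γ 0 0 * xy.1 + γ 0 1 * xy.2, γ 1 0 * xy.1 + γ 1 1 * xy.2)

/-- Unfolding of `vecAct`. [folklore] -/
theorem vecAct_apply (γ : Matrix (Fin 2) (Fin 2) (ZMod N)) (xy : ZMod N × ZMod N) :
    vecAct γ xy = (γ 0 0 * xy.1 + γ 0 1 * xy.2, γ 1 0 * xy.1 + γ 1 1 * xy.2) := rfl

/-- `vecAct` is an action: `(γ δ) · v = γ · (δ · v)`. [folklore] -/
theorem vecAct_mul (γ δ : Matrix (Fin 2) (Fin 2) (ZMod N)) (xy : ZMod N × ZMod N) :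
    vecAct (γ * δ) xy = vecAct γ (vecAct δ xy) := by
  simp only [vecAct, Matrix.mul_apply, Fin.sum_univ_two, Prod.mk.injEq]
  constructor <;> ring

/-- The identity matrix acts trivially. [folklore] -/
@[simp]
theorem vecAct_one (xy : ZMod N × ZMod N) :
    vecAct (1 : Matrix (Fin 2) (Fin 2) (ZMod N)) xy = xy := by
  obtain ⟨x, y⟩ := xy
  simp [vecAct]

/-- For `γ ∈ SL₂(ℤ/N)` the action on `(ℤ/N)²` is a bijection, with inverse the action of `γ⁻¹`.
[folklore] -/
def vecActEquiv (γ : SL(2, ZMod N)) : ZMod N × ZMod N ≃ ZMod N × ZMod N where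
  toFun := vecAct γ.1
  invFun := vecAct (γ⁻¹).1
  left_inv xy := by
    rw [← vecAct_mul, ← Matrix.SpecialLinearGroup.coe_mul, inv_mul_cancel,
      Matrix.SpecialLinearGroup.coe_one, vecAct_one]
  right_inv xy := by
    rw [← vecAct_mul, ← Matrix.SpecialLinearGroup.coe_mul, mul_inv_cancel,
      Matrix.SpecialLinearGroup.coe_one, vecAct_one]

/-- Unfolding of `vecActEquiv`. [folklore] -/
@[simp]
theorem vecActEquiv_apply (γ : SL(2, ZMod N)) (xy : ZMod N × ZMod N) :
    vecActEquiv γ xy = vecAct γ.1 xy := rfl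

end VecAct

/-! ### Powers of commuting `N`-torsion sections -/

variable {S : Scheme.{u}} {C : EllCurveOver S} {N : ℕ} (φ : LevelStructure N C)

/-- For an `N`-torsion section `P`, the power `P^{a.val}` (`a ∈ ℤ/N`) is additive in `a`.
[folklore] -/
theorem pow_val_add [NeZero N] {P : C.Sections} (hP : P ^ N = 1) (a b : ZMod N) :
    P ^ (a + b).val = P ^ a.val * P ^ b.val := by
  rw [ZMod.val_add, ← pow_eq_pow_mod _ hP, pow_add]

/-- For an `N`-torsion section `P`, `P^{(a b).val} = (P^{a.val})^{b.val}`. [folklore] -/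
theorem pow_val_mul {P : C.Sections} (hP : P ^ N = 1) (a b : ZMod N) :
    P ^ (a * b).val = (P ^ a.val) ^ b.val := by
  rw [ZMod.val_mul, ← pow_eq_pow_mod _ hP, pow_mul]

/-- `φ(a, b) = P^a Q^b` is `N`-torsion when `P` and `Q` commute. [folklore] -/
theorem section_pow_eq_one (hc : Commute φ.P φ.Q) (ab : ZMod N × ZMod N) :
    φ.section_ ab ^ N = 1 := by
  rw [section_, (hc.pow_pow _ _).mul_pow, ← pow_mul, ← pow_mul, mul_comm ab.1.val N,
    mul_comm ab.2.val N, pow_mul, pow_mul, φ.pow_P, φ.pow_Q, one_pow, one_pow, mul_one]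

/-- **Additivity of `(a, b) ↦ P^a Q^b` for commuting `P, Q`**: `φ(u)^x · φ(v)^y = φ(x u + y v)`
(coordinates: `(u₁ x + v₁ y, u₂ x + v₂ y)`). [folklore] -/
theorem section_pow_mul_section_pow [NeZero N] (hc : Commute φ.P φ.Q) (u v : ZMod N × ZMod N)
    (x y : ZMod N) :
    φ.section_ u ^ x.val * φ.section_ v ^ y.val =
      φ.section_ (u.1 * x + v.1 * y, u.2 * x + v.2 * y) := by
  simp only [section_]
  rw [(hc.pow_pow _ _).mul_pow, (hc.pow_pow _ _).mul_pow, pow_val_add φ.pow_P, pow_val_add φ.pow_Q,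
    pow_val_mul φ.pow_P, pow_val_mul φ.pow_P, pow_val_mul φ.pow_Q, pow_val_mul φ.pow_Q]
  exact (((hc.symm.pow_pow _ _).pow_pow _ _).mul_mul_mul_comm _ _)

/-! ### Twisting a level structure by `γ ∈ SL₂(ℤ/N)` -/

/-- **The level structure `φ ∘ γ`** for `γ ∈ SL₂(ℤ/N)`: the pair of sections
`(φ(γ₀₀, γ₁₀), φ(γ₀₁, γ₁₁)) = (P^{γ₀₀} Q^{γ₁₀}, P^{γ₀₁} Q^{γ₁₁})` — the columns of `γ` — is again a
full level-`N` structure: on every geometric fibre `(x, y) ↦ (P')^x (Q')^y = φ(γ · (x, y)ᵀ)` is the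
old basis precomposed with the bijection `γ` of `(ℤ/N)²` (Deligne (3.7): `GL₂(ℤ/n)` acts on the
level-`n` moduli problem by `α ↦ α ∘ g`; Katz–Mazur (3.1); this is the pair whose classifying map
`KugaSatoVariety.sl_extends` names). Requires `P` and `Q` to commute (automatic for an elliptic
curve, Katz–Mazur Thm. 2.1.2, but not recorded by `EllCurveOver`).
[cite: Deligne1971Bourbaki355, (3.7)] -/
def twist [NeZero N] (hc : Commute φ.P φ.Q) (γ : SL(2, ZMod N)) : LevelStructure N C where
  P := φ.section_ (γ.1 0 0, γ.1 1 0)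
  Q := φ.section_ (γ.1 0 1, γ.1 1 1)
  pow_P := φ.section_pow_eq_one hc _
  pow_Q := φ.section_pow_eq_one hc _
  basis_injective Ω _ _ s := by
    have key : (fun xy : ZMod N × ZMod N =>
        C.restrict s (φ.section_ (γ.1 0 0, γ.1 1 0) ^ xy.1.val *
          φ.section_ (γ.1 0 1, γ.1 1 1) ^ xy.2.val)) =
        (fun ab : ZMod N × ZMod N => C.restrict s (φ.P ^ ab.1.val * φ.Q ^ ab.2.val)) ∘
          vecActEquiv γ := by
      funext xy
      rw [φ.section_pow_mul_section_pow hc, Function.comp_apply, vecActEquiv_apply, vecAct_apply]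
      rfl
    rw [key]
    exact (φ.basis_injective s).comp (vecActEquiv γ).injective
  basis_surjective Ω _ _ s x hx := by
    obtain ⟨ab, hab⟩ := φ.basis_surjective s x hx
    refine ⟨(vecActEquiv γ).symm ab, ?_⟩
    rw [φ.section_pow_mul_section_pow hc, ← hab, ← vecAct_apply, ← vecActEquiv_apply,
      Equiv.apply_symm_apply]
    rfl

/-- The first section of `φ ∘ γ` is `P^{γ₀₀} Q^{γ₁₀}` (the shape used in
`KugaSatoVariety.sl_extends`). [folklore] -/
@[simp]
theorem twist_P [NeZero N] (hc : Commute φ.P φ.Q) (γ : SL(2, ZMod N)) :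
    (φ.twist hc γ).P = φ.section_ (γ.1 0 0, γ.1 1 0) := rfl

/-- The second section of `φ ∘ γ` is `P^{γ₀₁} Q^{γ₁₁}`. [folklore] -/
@[simp]
theorem twist_Q [NeZero N] (hc : Commute φ.P φ.Q) (γ : SL(2, ZMod N)) :
    (φ.twist hc γ).Q = φ.section_ (γ.1 0 1, γ.1 1 1) := rfl

/-- The basis sections of `φ ∘ γ`: `(φ ∘ γ)(x, y) = φ(γ · (x, y)ᵀ)`. [folklore] -/
theorem twist_section_ [NeZero N] (hc : Commute φ.P φ.Q) (γ : SL(2, ZMod N))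
    (xy : ZMod N × ZMod N) : (φ.twist hc γ).section_ xy = φ.section_ (vecAct γ.1 xy) := by
  rw [section_, twist_P, twist_Q, φ.section_pow_mul_section_pow hc, vecAct_apply]

/-- Twisting by the identity matrix does nothing. [folklore] -/
theorem twist_one_P [NeZero N] (hc : Commute φ.P φ.Q) : (φ.twist hc 1).P = φ.P := by
  rw [twist_P, section_, Matrix.SpecialLinearGroup.coe_one, Matrix.one_apply_eq,
    Matrix.one_apply_ne (by decide), ZMod.val_zero, pow_zero, mul_one, ZMod.val_one_eq_one_mod,
    ← pow_eq_pow_mod _ φ.pow_P, pow_one]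

/-- Twisting by the identity matrix does nothing. [folklore] -/
theorem twist_one_Q [NeZero N] (hc : Commute φ.P φ.Q) : (φ.twist hc 1).Q = φ.Q := by
  rw [twist_Q, section_, Matrix.SpecialLinearGroup.coe_one, Matrix.one_apply_eq,
    Matrix.one_apply_ne (by decide), ZMod.val_zero, pow_zero, one_mul, ZMod.val_one_eq_one_mod,
    ← pow_eq_pow_mod _ φ.pow_Q, pow_one]


/-! ### Twisting by `GL₂(ℤ/N) = (M₂(ℤ/N))ˣ` -/

section GeneralLinear

variable {N : ℕ}

/-- For an invertible `2 × 2` matrix `γ ∈ GL₂(ℤ/N) = (M₂(ℤ/N))ˣ` the action on `(ℤ/N)²` is a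
bijection, with inverse the action of `γ⁻¹`. [folklore] -/
def vecActEquivOfUnit (γ : (Matrix (Fin 2) (Fin 2) (ZMod N))ˣ) :
    ZMod N × ZMod N ≃ ZMod N × ZMod N where
  toFun := vecAct γ.1
  invFun := vecAct (γ⁻¹).1
  left_inv xy := by rw [← vecAct_mul, Units.inv_mul, vecAct_one]
  right_inv xy := by rw [← vecAct_mul, Units.mul_inv, vecAct_one]

/-- Unfolding of `vecActEquivOfUnit`. [folklore] -/
@[simp]
theorem vecActEquivOfUnit_apply (γ : (Matrix (Fin 2) (Fin 2) (ZMod N))ˣ) (xy : ZMod N × ZMod N) :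
    vecActEquivOfUnit γ xy = vecAct γ.1 xy := rfl

end GeneralLinear

/-- **The level structure `φ ∘ γ` for `γ ∈ GL₂(ℤ/N)`** (`= (M₂(ℤ/N))ˣ`; Deligne (3.7): "le groupe
`GL₂(ℤ/n)` agit sur `M_n` par `α ↦ α ∘ g`"; Deninger–Scholl (4.10)): the columns
`(φ(γ₀₀, γ₁₀), φ(γ₀₁, γ₁₁))` of `γ` form a full level-`N` structure, exactly as for `SL₂`
(`LevelStructure.twist`, which is the case `γ = Matrix.SpecialLinearGroup.toGL g`, same
underlying matrix). The full `GL₂(ℤ/N)`-action permutes the components of `Y(N)_K`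
(through `det`, via the Weil pairing), whence only `SL₂` appears in `KugaSatoVariety`.
Requires `P` and `Q` to commute. [cite: Deligne1971Bourbaki355, (3.7)] -/
def twistGL [NeZero N] (hc : Commute φ.P φ.Q) (γ : (Matrix (Fin 2) (Fin 2) (ZMod N))ˣ) :
    LevelStructure N C where
  P := φ.section_ (γ.1 0 0, γ.1 1 0)
  Q := φ.section_ (γ.1 0 1, γ.1 1 1)
  pow_P := φ.section_pow_eq_one hc _
  pow_Q := φ.section_pow_eq_one hc _
  basis_injective Ω _ _ s := by
    have key : (fun xy : ZMod N × ZMod N =>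
        C.restrict s (φ.section_ (γ.1 0 0, γ.1 1 0) ^ xy.1.val *
          φ.section_ (γ.1 0 1, γ.1 1 1) ^ xy.2.val)) =
        (fun ab : ZMod N × ZMod N => C.restrict s (φ.P ^ ab.1.val * φ.Q ^ ab.2.val)) ∘
          vecActEquivOfUnit γ := by
      funext xy
      rw [φ.section_pow_mul_section_pow hc, Function.comp_apply, vecActEquivOfUnit_apply,
        vecAct_apply]
      rfl
    rw [key]
    exact (φ.basis_injective s).comp (vecActEquivOfUnit γ).injective
  basis_surjective Ω _ _ s x hx := by
    obtain ⟨ab, hab⟩ := φ.basis_surjective s x hx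
    refine ⟨(vecActEquivOfUnit γ).symm ab, ?_⟩
    rw [φ.section_pow_mul_section_pow hc, ← hab, ← vecAct_apply, ← vecActEquivOfUnit_apply,
      Equiv.apply_symm_apply]
    rfl

/-- The first section of `φ ∘ γ`, `γ ∈ GL₂(ℤ/N)`, is `P^{γ₀₀} Q^{γ₁₀}`. [folklore] -/
@[simp]
theorem twistGL_P [NeZero N] (hc : Commute φ.P φ.Q) (γ : (Matrix (Fin 2) (Fin 2) (ZMod N))ˣ) :
    (φ.twistGL hc γ).P = φ.section_ (γ.1 0 0, γ.1 1 0) := rfl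

/-- The second section of `φ ∘ γ`, `γ ∈ GL₂(ℤ/N)`, is `P^{γ₀₁} Q^{γ₁₁}`. [folklore] -/
@[simp]
theorem twistGL_Q [NeZero N] (hc : Commute φ.P φ.Q) (γ : (Matrix (Fin 2) (Fin 2) (ZMod N))ˣ) :
    (φ.twistGL hc γ).Q = φ.section_ (γ.1 0 1, γ.1 1 1) := rfl

/-- The basis sections of `φ ∘ γ`, `γ ∈ GL₂(ℤ/N)`: `(φ ∘ γ)(x, y) = φ(γ · (x, y)ᵀ)`. [folklore] -/
theorem twistGL_section_ [NeZero N] (hc : Commute φ.P φ.Q) (γ : (Matrix (Fin 2) (Fin 2) (ZMod N))ˣ)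
    (xy : ZMod N × ZMod N) : (φ.twistGL hc γ).section_ xy = φ.section_ (vecAct γ.1 xy) := by
  rw [section_, twistGL_P, twistGL_Q, φ.section_pow_mul_section_pow hc, vecAct_apply]

/-- `SL₂`- and `GL₂`-twists with the same underlying matrix agree on `P`. [folklore] -/
theorem twist_P_eq_twistGL_P [NeZero N] (hc : Commute φ.P φ.Q) (g : SL(2, ZMod N))
    (γ : (Matrix (Fin 2) (Fin 2) (ZMod N))ˣ) (h : γ.1 = g.1) :
    (φ.twist hc g).P = (φ.twistGL hc γ).P := by
  rw [twist_P, twistGL_P, h]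

/-- `SL₂`- and `GL₂`-twists with the same underlying matrix agree on `Q`. [folklore] -/
theorem twist_Q_eq_twistGL_Q [NeZero N] (hc : Commute φ.P φ.Q) (g : SL(2, ZMod N))
    (γ : (Matrix (Fin 2) (Fin 2) (ZMod N))ˣ) (h : γ.1 = g.1) :
    (φ.twist hc g).Q = (φ.twistGL hc γ).Q := by
  rw [twist_Q, twistGL_Q, h]

end EllCurveOver.LevelStructure

end Literature.NumberTheory.EllipticCurves

end
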